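import Literature.AlgebraicGeometry.ComplexMultiplication.CyclotomicFermatCMTypesKoblitzListTwoOddPrimesAll
import Literature.AlgebraicGeometry.ComplexMultiplication.CyclotomicFermatCMTypesKoblitzListPrimePowers
import HarnessLib

/-!
# Koblitz's list at every ODD level with at most two prime factors: a primitive group triple forces `N ∈ {3, 7, 15, 21, 39}`

Layer `Literature/AlgebraicGeometry/ComplexMultiplication`, namespace `…ComplexMultiplication.CyclotomicFermatCMType`; packaging of
`…KoblitzListPrimePowers` (gen 42: prime-power levels, `pᵏ ∈ {3, 4, 7, 8, 16}`) and `…KoblitzListTwoOddPrimesAll` (this lane gen 44: two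
distinct odd primes, `N ∈ {15, 21, 39}`).  THEOREMS ONLY (no definition, no named fact, no `sorry`).

SOURCE.  M. Bauer, A. Coste, C. Itzykson, P. Ruelle, *J. Geom. Phys.* **22** (1997) §3.4 p. 14 (held: `paper:arxiv-hep-th_9604104`): Koblitz's
list `{3, 4, 6, 7, 8, 12, 15, 16, 18, 20, 21, 22, 24, 30, 39, 40, 48, 60}` [kob] — its ODD members are exactly `3, 7, 15, 21, 39`, all with at
most two prime factors ([kob] = N. Koblitz, Duke Math. J. **45** (1978) 87–99, NOT held, acq-13447; the proofs here are ours).  N. Koblitz,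
D. Rohrlich, *Canad. J. Math.* **30** (1978) §2 p. 1187.

THE POINT.  One statement for the successor and the reader: **at an odd level `N` with `|primeFactors N| ≤ 2`, a primitive normalised triple with
`H_{r,s,t}` a group forces `N ∈ {3, 7, 15, 21, 39}`** — the odd part of the printed list restricted to such levels is thereby PROVED (existence at
these five levels being the census).  What remains of the odd part of [kob]: levels with three or more distinct prime factors (none printed).

## What is proved (namespace `…CyclotomicFermatCMType`)

* **`eq_pow_or_eq_pow_mul_pow_of_card_primeFactors_le_two`** — arithmetic: `N ≥ 2` with at most two prime factors is `pᵏ` (`k ≥ 1`) or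
  `pᵃ⁺¹qᵇ⁺¹` (`p ≠ q`).
* **`mem_of_forall_mul_mem_odd_of_card_primeFactors_le_two`** — the headline.

## Honest column / NOT here

* Odd levels with `≥ 3` prime factors and all even levels beyond the settled families remain CITE [kob].  `J(F_n)` is not constructed.  HC_CM is
  NOT proved and nothing here bears on it.

## References

* [BauerCosteItzyksonRuelle1997] M. Bauer, A. Coste, C. Itzykson, P. Ruelle, J. Geom. Phys. 22 (1997) 134–189, §3.4 (p. 14).
* [KoblitzRohrlich1978] N. Koblitz, D. Rohrlich, Canad. J. Math. 30 (1978) 1183–1205, §2 (p. 1187).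
* [kob] N. Koblitz, Duke Math. J. 45 (1978) 87–99 — cited for the statement of the list only; not held, not used.

## Provenance

Cell `pub-hodgecm2` (COR-CM), literature seat `lit-deligne-3` gen 44 (claim KOBLITZ-ODD-TWO-PRIME-FACTORS; count-neutral, own lane).  HC_CM is NOT
proved and nothing here bears on it.
-/

noncomputable section

open NumberField

namespace Literature.AlgebraicGeometry.ComplexMultiplication

open Literature.AlgebraicGeometry.HodgeTheory (fermatCMType)

namespace CyclotomicFermatCMType

section OddTwoPrimeFactors

variable {N : ℕ} [NeZero N]

omit [NeZero N] in
/-- **Arithmetic**: a natural number `N ≥ 2` with at most two prime factors is a prime power `pᵏ` (`k ≥ 1`) or a product `pᵃ⁺¹·qᵇ⁺¹` of powers of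
two distinct primes. [folklore] [cite: BauerCosteItzyksonRuelle1997, §3.4] -/
theorem eq_pow_or_eq_pow_mul_pow_of_card_primeFactors_le_two (h2 : 2 ≤ N) (hω : N.primeFactors.card ≤ 2) :
    (∃ p k : ℕ, p.Prime ∧ 1 ≤ k ∧ N = p ^ k) ∨ (∃ p q a b : ℕ, p.Prime ∧ q.Prime ∧ p ≠ q ∧ N = p ^ (a + 1) * q ^ (b + 1)) := by
  have hN0 : N ≠ 0 := by omega
  have hprod : N.factorization.prod (· ^ ·) = N := Nat.prod_factorization_pow_eq_self hN0
  have hne : N.primeFactors ≠ ∅ := by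
    rw [Ne, Nat.primeFactors_eq_empty]; omega
  have hcard : N.primeFactors.card = 1 ∨ N.primeFactors.card = 2 := by
    have : N.primeFactors.card ≠ 0 := by rwa [Ne, Finset.card_eq_zero]
    omega
  rcases hcard with h1 | h2'
  · left
    obtain ⟨p, hp⟩ := Finset.card_eq_one.1 h1
    have hpmem : p ∈ N.primeFactors := by rw [hp]; exact Finset.mem_singleton_self p
    refine ⟨p, N.factorization p, Nat.prime_of_mem_primeFactors hpmem, ?_, ?_⟩
    · exact Nat.pos_of_ne_zero (Finsupp.mem_support_iff.1 (by rw [Nat.support_factorization]; exact hpmem))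
    · conv_lhs => rw [← hprod]
      rw [Finsupp.prod, Nat.support_factorization, hp, Finset.prod_singleton]
  · right
    obtain ⟨p, q, hpq, hs⟩ := Finset.card_eq_two.1 h2'
    have hpmem : p ∈ N.primeFactors := by rw [hs]; simp
    have hqmem : q ∈ N.primeFactors := by rw [hs]; simp
    have hpa : N.factorization p ≠ 0 := Finsupp.mem_support_iff.1 (by rw [Nat.support_factorization]; exact hpmem)
    have hqb : N.factorization q ≠ 0 := Finsupp.mem_support_iff.1 (by rw [Nat.support_factorization]; exact hqmem)
    refine ⟨p, q, N.factorization p - 1, N.factorization q - 1, Nat.prime_of_mem_primeFactors hpmem, Nat.prime_of_mem_primeFactors hqmem,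
      hpq, ?_⟩
    rw [Nat.sub_add_cancel (Nat.pos_of_ne_zero hpa), Nat.sub_add_cancel (Nat.pos_of_ne_zero hqb)]
    conv_lhs => rw [← hprod]
    rw [Finsupp.prod, Nat.support_factorization, hs, Finset.prod_pair hpq]

/-- **KOBLITZ'S LIST AT EVERY ODD LEVEL WITH AT MOST TWO PRIME FACTORS**: if `N` is odd with `|primeFactors N| ≤ 2` and some primitive normalised
triple `(r, s, −r−s)` modulo `N` has `H_{r,s,t}` closed under multiplication, then `N ∈ {3, 7, 15, 21, 39}` — exactly the odd printed levels
(prime powers: gen 42; two distinct odd primes: the prequel). [cite: BauerCosteItzyksonRuelle1997, §3.4] [cite: KoblitzRohrlich1978, §2 (p. 1187)] -/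
theorem mem_of_forall_mul_mem_odd_of_card_primeFactors_le_two (hodd : ¬2 ∣ N) (hω : N.primeFactors.card ≤ 2) {r s : ZMod N} (hr : r ≠ 0)
    (hs : s ≠ 0) (hrs : r.val + s.val < N) (hprim : Nat.gcd (Nat.gcd r.val s.val) N = 1)
    (hcl : ∀ a ∈ fermatCMType N r s (-(r + s)), ∀ b ∈ fermatCMType N r s (-(r + s)), a * b ∈ fermatCMType N r s (-(r + s))) :
    N ∈ ({3, 7, 15, 21, 39} : Finset ℕ) := by
  -- `N ≥ 3` from the admissible triple
  have hrv : r.val ≠ 0 := fun h0 => hr ((ZMod.val_eq_zero r).1 h0)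
  have hsv : s.val ≠ 0 := fun h0 => hs ((ZMod.val_eq_zero s).1 h0)
  have hN3 : 3 ≤ N := by omega
  rcases eq_pow_or_eq_pow_mul_pow_of_card_primeFactors_le_two (by omega) hω with ⟨p, k, hp, hk, hN⟩ | ⟨p, q, a, b, hp, hq, hpq, hN⟩
  · -- prime power
    haveI : Fact p.Prime := ⟨hp⟩
    have h3 : 3 ≤ p ^ k := by rw [← hN]; exact hN3
    subst hN
    have hmem := (exists_primitive_group_triple_iff_primePow hk h3).1 ⟨r, s, hr, hs, hrs, hprim, hcl⟩
    have hp2 : p ≠ 2 := by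
      rintro rfl
      exact hodd (dvd_pow_self 2 (by omega))
    have hpodd : p % 2 = 1 := Nat.odd_iff.1 (hp.odd_of_ne_two hp2)
    have hodd' : (p ^ k) % 2 = 1 := by
      rw [Nat.pow_mod, hpodd, one_pow]; norm_num
    simp only [Finset.mem_insert, Finset.mem_singleton] at hmem ⊢
    omega
  · -- two distinct odd primes
    haveI : Fact p.Prime := ⟨hp⟩
    haveI : Fact q.Prime := ⟨hq⟩
    have hp2 : p ≠ 2 := by
      rintro rfl
      exact hodd (by rw [hN]; exact dvd_mul_of_dvd_left (dvd_pow_self 2 (by omega)) _)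
    have hq2 : q ≠ 2 := by
      rintro rfl
      exact hodd (by rw [hN]; exact dvd_mul_of_dvd_right (dvd_pow_self 2 (by omega)) _)
    have h := mem_of_forall_mul_mem_two_odd_primes hp2 hq2 hpq hN hr hs hrs hprim hcl
    simp only [Finset.mem_insert, Finset.mem_singleton] at h ⊢
    omega

end OddTwoPrimeFactors

end CyclotomicFermatCMType

end Literature.AlgebraicGeometry.ComplexMultiplication
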